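import Mathlib.MeasureTheory.Integral.DominatedConvergence
import Literature.Analysis.FluidPDE.StatisticalSolution
import HarnessLib

/-!
# Stub `stub_limitExact` (S3) of line `cutoff_compactness`
# (crux stmt-AnomalousDissipation-18402, `TameRoughRigidity.TameClosure`)

THE ABSTRACT LIMIT LEMMA of the cut-off/compactness closure of near-stationary tame statistics
(pure measure theory on the energy space `H = L²_σ(T³)`; only its norm, topology and Borel σ-algebra
are used). Let `μₙ → μ'` against bounded continuous observables, `μ'` a probability measure with
integrable energy `∫ |v|² dμ' < ∞`, and let `F : H → ℝ` be continuous with `|F(v)| ≤ A (1 + |v|²)`.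
Suppose that for every `ε > 0` there is `ρ₀` such that for every `ρ ≥ ρ₀` a continuous cut-off
`c : H → [0,1]` with `c = 1` on `{|v|² ≤ ρ}` and a bounded continuous `h : H → ℝ` exist with
`|∫ cF dμ' − ∫ h dμ'| ≤ ε`, `|∫ cF dμₙ − ∫ h dμₙ| ≤ ε` for all `n`, and `|∫ cF dμₙ| ≤ ε` eventually.
Then `F ∈ L¹(μ')` and `∫ F dμ' = 0`.

Proof. Integrability: `F` is continuous, hence Borel measurable, and dominated by the integrable
`A (1 + |v|²)`. Vanishing of the mean: fix `ε > 0` and run the scheme along `ρ_k = ρ₀ + k`, obtaining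
`(c_k, h_k)`. For each `k`, eventually `|∫ h_k dμₙ| ≤ |∫ c_k F dμₙ| + ε ≤ 2ε`, and `∫ h_k dμₙ → ∫ h_k dμ'`
(`h_k` is bounded continuous), so `|∫ h_k dμ'| ≤ 2ε` and `|∫ c_k F dμ'| ≤ 3ε`. Finally
`∫ c_k F dμ' → ∫ F dμ'` as `k → ∞` by dominated convergence on the single measure `μ'`
(`|c_k F| ≤ |F|`, and `c_k(v) = 1` as soon as `|v|² ≤ ρ₀ + k`), whence `|∫ F dμ'| ≤ 3ε` for every
`ε > 0`, i.e. `∫ F dμ' = 0`.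

References: P. Billingsley, *Convergence of Probability Measures*, 2nd ed. (Wiley 1999), §3
(uniform integrability and weak limits); C. Foias, O. Manley, R. Rosa, R. Temam, *Navier–Stokes
Equations and Turbulence* (CUP 2001), Ch. IV App. B.1–B.2 (the cut-off tests this lemma serves).
-/

set_option linter.dupNamespace false

noncomputable section

namespace Summit.AnomalousDissipation.AnomalousDissipation.Theorems.TameRoughRigidity.TameClosure

open MeasureTheory Filter Topology UnitAddTorus
open scoped InnerProductSpace RealInnerProductSpace ENNReal NNReal
open Literature.Analysis.FunctionSpaces Literature.Analysis.FluidPDE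

/-- Local notation: real vector fields on `T³`. -/
local notation "Vec3" => (UnitAddTorus (Fin 3)) → (EuclideanSpace ℝ (Fin 3))
/-- Local notation: `L²(T³; ℝ³)`. -/
local notation "L2" => (Lp (EuclideanSpace ℝ (Fin 3)) 2 (volume : Measure (UnitAddTorus (Fin 3))))
/-- Local notation: the energy space `H`. -/
local notation "H3" => (Torus.energySpace (Fin 3))

/-! ## Two elementary real-number steps -/

/-- If `|a| ≤ ε` and `|a - b| ≤ ε` then `|b| ≤ 2ε`. [folklore] -/
theorem limitExact_abs_le_two_mul {a b ε : ℝ} (ha : |a| ≤ ε) (hab : |a - b| ≤ ε) : |b| ≤ 2 * ε := by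
  have h : b = a - (a - b) := by ring
  rw [h]
  exact (abs_sub a (a - b)).trans (by linarith)

/-- A real number whose absolute value is at most `3ε` for every `ε > 0` vanishes. [folklore] -/
theorem limitExact_eq_zero_of_abs_le {a : ℝ} (h : ∀ ε : ℝ, 0 < ε → |a| ≤ 3 * ε) : a = 0 := by
  by_contra hne
  have hpos : 0 < |a| := abs_pos.2 hne
  have h4 := h (|a| / 4) (by positivity)
  linarith

/-! ## The stub -/

/-- **S3 `stub_limitExact`** — THE ABSTRACT LIMIT LEMMA (pure measure theory on the metric space `H`).
Let `μₙ → μ'` against bounded continuous observables, all probability measures, `μ'` with integrable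
energy; let `F : H → ℝ` be continuous with `|F(v)| ≤ A(1 + |v|²)`. If for every `ε > 0` there is `ρ₀`
such that for every `ρ ≥ ρ₀` a continuous cut-off `c : H → [0,1]`, `c = 1` on `{|v|² ≤ ρ}`, and a bounded
continuous `h` exist with `|∫ cF dμ' − ∫ h dμ'| ≤ ε`, `|∫ cF dμₙ − ∫ h dμₙ| ≤ ε` for all `n`, and
`|∫ cF dμₙ| ≤ ε` eventually, then `F ∈ L¹(μ')` and `∫ F dμ' = 0`. Proof: integrability from
continuity and the quadratic bound; along `ρ_k = ρ₀ + k`,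
`|∫ c_k F dμ'| ≤ ε + |∫ h_k dμ'| = ε + lim |∫ h_k dμₙ| ≤ ε + limsup (|∫ c_k F dμₙ| + ε) ≤ 3ε`, and
`∫ c_k F dμ' → ∫ F dμ'` by dominated convergence for the single measure `μ'`. [folklore] -/
theorem stub_limitExact (μ : ℕ → Measure H3) (μ' : Measure H3)
    (hprob : ∀ n, IsProbabilityMeasure (μ n)) (hprob' : IsProbabilityMeasure μ')
    (hweak : ∀ h : H3 → ℝ, Continuous h → (∃ C : ℝ, ∀ v, |h v| ≤ C) →
      Tendsto (fun n => ∫ v, h v ∂(μ n)) atTop (𝓝 (∫ v, h v ∂μ')))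
    (hint' : Integrable (fun v : H3 => ‖v‖ ^ 2) μ')
    (F : H3 → ℝ) (hFc : Continuous F) (A : ℝ) (hFA : ∀ v, |F v| ≤ A * (1 + ‖v‖ ^ 2))
    (hscheme : ∀ ε : ℝ, 0 < ε → ∃ ρ₀ : ℝ, ∀ ρ : ℝ, ρ₀ ≤ ρ →
      ∃ (c h : H3 → ℝ), Continuous c ∧ Continuous h ∧ (∀ v, 0 ≤ c v ∧ c v ≤ 1) ∧
        (∀ v : H3, ‖v‖ ^ 2 ≤ ρ → c v = 1) ∧ (∃ C : ℝ, ∀ v, |h v| ≤ C) ∧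
        |(∫ v, c v * F v ∂μ') - ∫ v, h v ∂μ'| ≤ ε ∧
        (∀ n, |(∫ v, c v * F v ∂(μ n)) - ∫ v, h v ∂(μ n)| ≤ ε) ∧
        (∀ᶠ n in atTop, |∫ v, c v * F v ∂(μ n)| ≤ ε)) :
    Integrable F μ' ∧ ∫ v, F v ∂μ' = 0 := by
  -- the probability hypotheses are part of the registered interface; the argument below only uses
  -- the weak convergence and the integrability of the energy
  have _ := hprob
  have _ := hprob'
  -- (a) integrability from continuity and the quadratic bound
  have hFi : Integrable F μ' := by
    refine Integrable.mono' (((integrable_const (1 : ℝ)).add hint').const_mul A)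
      hFc.aestronglyMeasurable (ae_of_all _ fun v => ?_)
    rw [Real.norm_eq_abs]
    exact hFA v
  refine ⟨hFi, limitExact_eq_zero_of_abs_le fun ε hε => ?_⟩
  -- (b) the scheme along `ρ_k = ρ₀ + k`
  obtain ⟨ρ₀, hρ₀⟩ := hscheme ε hε
  have hk : ∀ k : ℕ, ρ₀ ≤ ρ₀ + (k : ℝ) := fun k => le_add_of_nonneg_right (Nat.cast_nonneg k)
  choose c h hc hh hc01 hc1 hhb hcμ' hcμ hcev using fun k : ℕ => hρ₀ (ρ₀ + (k : ℝ)) (hk k)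
  -- `|∫ c_k F dμ'| ≤ 3ε` for every `k`, through the weak limit of the bounded continuous `h_k`
  have hbound : ∀ k, |∫ v, c k v * F v ∂μ'| ≤ 3 * ε := by
    intro k
    have hev2 : ∀ᶠ n in atTop, |∫ v, h k v ∂(μ n)| ≤ 2 * ε := by
      filter_upwards [hcev k] with n hn
      exact limitExact_abs_le_two_mul hn (hcμ k n)
    have hlim : |∫ v, h k v ∂μ'| ≤ 2 * ε :=
      le_of_tendsto (hweak (h k) (hh k) (hhb k)).abs hev2
    have hsplit : ∫ v, c k v * F v ∂μ' =
        ((∫ v, c k v * F v ∂μ') - ∫ v, h k v ∂μ') + ∫ v, h k v ∂μ' := by ring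
    rw [hsplit]
    refine (abs_add_le _ _).trans ?_
    linarith [hcμ' k, hlim]
  -- `∫ c_k F dμ' → ∫ F dμ'` by dominated convergence on the single measure `μ'`
  have hlimF : Tendsto (fun k => ∫ v, c k v * F v ∂μ') atTop (𝓝 (∫ v, F v ∂μ')) := by
    refine tendsto_integral_of_dominated_convergence (fun v => ‖F v‖)
      (fun k => ((hc k).mul hFc).aestronglyMeasurable) hFi.norm
      (fun k => ae_of_all _ fun v => ?_) (ae_of_all _ fun v => ?_)
    · rw [norm_mul, Real.norm_eq_abs, abs_of_nonneg (hc01 k v).1]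
      exact mul_le_of_le_one_left (norm_nonneg _) (hc01 k v).2
    · refine tendsto_const_nhds.congr' ?_
      obtain ⟨N, hN⟩ := exists_nat_ge (‖v‖ ^ 2 - ρ₀)
      filter_upwards [Filter.eventually_ge_atTop N] with k hk'
      have hNk : (N : ℝ) ≤ (k : ℝ) := Nat.cast_le.2 hk'
      rw [hc1 k v (by linarith), one_mul]
  exact le_of_tendsto' hlimF.abs hbound

end Summit.AnomalousDissipation.AnomalousDissipation.Theorems.TameRoughRigidity.TameClosure

end
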